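import Summits.BirchSwinnertonDyer.BirchSwinnertonDyer.Theorems.SignedBaseChangeAnticyclotomicEisensteinDivisibilitySpecializationRat
import Summits.BirchSwinnertonDyer.BirchSwinnertonDyer.Theorems.SignedBaseChangeAnticyclotomicEisensteinDivisibilityExactControlDuality
import Summits.BirchSwinnertonDyer.BirchSwinnertonDyer.Theorems.SignedBaseChangeAnticyclotomicEisensteinDivisibilityXGrTwoModuleFinite
import Summits.BirchSwinnertonDyer.BirchSwinnertonDyer.Theorems.SignedBaseChangeAnticyclotomicEisensteinDivisibilityRatToInt
import Literature.NumberTheory.EllipticCurves.Castella2018.AnticyclotomicSelmerDualModuleFinite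
import HarnessLib

/-!
# Specialisation `T₁ ↦ 0` of characteristic ideals in the LOWER-BOUND (Eisenstein) direction:
# `p^k · ch_Λ(X_ac) ⊆ π(ch_{Λ₂}(X_Gr₂))·𝒪⟦T⟧` from CONTROL WITH FINITE-EXPONENT KERNEL, and the
# ♭-INCLUSION from a two-variable Greenberg inclusion (helper for cruxes `GordTwoRankZeroOffCaseOne`
# stmt-BirchSwinnertonDyer-19357 / `MultLower` stmt-19359, lines `three_field_road` / `tame_roads_mult`, stub
# `stub_tameFlatInclusion{R0,M}`)

Lead seat cruxlead-19357 (gen 6). The one open mathematical stub of the three tame lines (19357/19358/19359, v17)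
is the ♭-INCLUSION `Ch_Λ(X_ac^∅(E_K)_{𝔭′})·𝒪_{ℂ_p}⟦T⟧ ⊆ (Q)` for ♭-frames `Q` — in print, ONE divisibility of a
TWO-VARIABLE Rankin–Selberg main conjecture (Wan, ANT 14 (2020) Thm. 1.1, for the good partner `E ⊗ χ_{p*}` with
the tame character `χ_{p*}∘N_{K/ℚ}`; `X_{f,K,ξ}` there has exactly the Greenberg conditions of the tree's
`unrSelmer₂`/`XGr₂`: nothing above `v₀`, unramified above `v̄₀` and away from `p`) SPECIALISED to the anticyclotomic
line (Jetchev–Skinner–Wan 2017 §3.4 Lemma 3.4.1 / Cor. 3.4.2 = "bigSelmercontrol": `ch(X_ac^Σ) ⊆ ch(X_Gr^Σ(𝓜)) mod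
(γ₊ − 1)` from a control map with FINITE kernel). This file is the SPECIALISATION STEP as pure algebra over the
tree's CONSTRUCTED carriers `X_Gr₂ = WeierstrassCurve.XGr₂` (`Λ₂ = ℤ_p⟦T₂⟧⟦T₁⟧`) and `X_ac = AcSelmer.XAc … ∅`
(`Λ₁ = ℤ_p⟦T₂⟧`), in the direction OPPOSITE to the Euler-system specialisation of cell bsd-wall / seat sbc-p1
(`SignedBaseChangeAcDivSpecialization.S2.map_toUnr₂_map_constantCoeff_le_rat`: `p^k·π(ch X_Gr₂) ⊆ ch(X_ac)`):

* §1 `S2L.map_le_map_toUnr₂_map_constantCoeff_rat` — generic `Λ₂/Λ₁`: `X` finitely generated over `Λ₂`, `Y`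
  finitely generated TORSION over `Λ₁`, `f : X/T₁X ↠ Y` a surjective `Λ₁`-linear map (constants structure) whose
  KERNEL HAS FINITE EXPONENT (`f q = 0 ⟹ p^m q = 0`). Then `X/T₁X` is `Λ₁`-torsion (so `X` is killed by some `s`
  with `s(0) ≠ 0`, determinant trick `S2.exists_constantCoeff_ne_zero_of_isTorsion`), and
  `(p^a)·ch(Y) ⊆ ch(ker f)·ch(Y) = ch(X/T₁X) = ch(X[T₁])·π(ch X) ⊆ π(ch X)` (multiplicativity
  `Module.charIdeal_eq_mul_of_exact`, Herbrand `PowerSeriesSpecialization.charIdeal_quotSMulTop_eq_mul`,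
  `p^a ∈ ch(ker f)` by `Module.exists_pow_mem_charIdeal_of_pow_smul_eq_zero`); extend scalars along
  `J : ℤ_p → 𝒪_{ℂ_p}`: `∃ k, ∀ y ∈ ch(Y)·𝒪⟦T⟧, C(p^k)·y ∈ π(ch(X)·Λ^ur)`.
* §2 `S2L.pow_smul_eq_zero_of_toXAcQuot_eq_zero` — Pontryagin duality WITH EXPONENT (the `p^m`-version of
  sbc-p1's `XGr₂.toXAcQuot_injective_of_forall_mem_range`): if every `conj_{γ₁}`-fixed class `s` of
  `H¹_{nr,v̄}(K̃_∞, E[p^∞])` has `p^m·s` in the range of restriction from `Sel_v̄^∅(K_∞^{(2)}, E[p^∞])`, then the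
  kernel of `toXAcQuot : X_Gr₂/T₁ → X_ac` is killed by `p^m` (`mem_X_smul_top_of_forall`).
  `S2L.charIdeal_XAc_map_le_rat` — the curve-level form: for `W` elliptic over a number field `K` with
  `E(K)[p] = 0`, a generator pair, `X_ac` torsion, and control-with-exponent, `∃ k, C(p^k)·ch(X_ac)·𝒪⟦T⟧ ⊆
  π(ch(X_Gr₂)·Λ^ur)` (membership form; `Module.Finite` of `X_Gr₂` is sbc-p1's `xGr₂_module_finite`, of `X_ac`
  the tree's `XAc.module_finite_empty`; surjectivity of control is bsd-wall's `toXAcQuot_surjective`).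
* §3 `S2L.charIdeal_XAc_map_le_span_of_twoVar` — THE ♭-INCLUSION AT ONE DATUM from (i) a RATIONAL two-variable
  inclusion `p^k·ch(X_Gr₂)·Λ^ur ⊆ (G)` for some `G ∈ 𝒪_{ℂ_p}⟦T₁⟧⟦T₂⟧` whose restriction to `T₁ = 0` generates
  `(Q)`, (ii) control-with-exponent, (iii) `X_ac` torsion and (iv) `μ(Q) = 0` (`HasUnitContent Q`, the
  rational-to-integral cancellation `SignedBaseChangeAcDivRatToInt.le_span_of_forall_C_pow_mul_mem_of_hasUnitContent`):
  `ch_Λ(X_ac)·𝒪_{ℂ_p}⟦T⟧ ⊆ (Q)`.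

Pure commutative algebra and Pontryagin duality over constructed modules; nothing about `L`-functions, main
conjectures or BSD is asserted; no definitions; no named fact. BSD is not proved by any of this.
References: Jetchev–Skinner–Wan, Camb. J. Math. 5 (2017) §3.4 (arXiv:1512.06894 pp. 14–15: Lemma "bigSelmercontrol"
and its Corollary); Skinner–Urban, Invent. Math. 195 (2014) §3.2.7–3.2.9, Cor. 3.2.9; Ochiai 2006 Lemma 7.2;
Bourbaki AC VII §4.5.
-/

-- D-0017: single-problem summit, the namespace repeats the problem name by design.
set_option linter.dupNamespace false
set_option autoImplicit false

noncomputable section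

open Function
open scoped Pointwise Classical

namespace Summit.BirchSwinnertonDyer.BirchSwinnertonDyer.Theorems.TameSpecialization

open Literature.NumberTheory.EllipticCurves Literature.NumberTheory.EllipticCurves.Module
open Literature.NumberTheory.EllipticCurves.GreenbergVatsal2000
open Summit.BirchSwinnertonDyer.BirchSwinnertonDyer.Theorems.SignedBaseChangeAcDivSpecialization
open Summit.BirchSwinnertonDyer.BirchSwinnertonDyer.Theorems.SignedBaseChangeAcDivSpecialization.PowerSeriesSpecialization

namespace S2L

universe u

/-! ## §1. Generic `Λ₂ → Λ₁`: control with finite-exponent kernel ⟹ `p^k·ch(Y) ⊆ π(ch X)` -/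

/-- **Lower-bound specialisation for `Λ₂ = ℤ_p⟦T₂⟧⟦T₁⟧ → Λ₁ = ℤ_p⟦T₂⟧`-modules with control.** Let `X` be a
finitely generated `Λ₂`-module, `Y` a finitely generated torsion `Λ₁`-module and `f : X/T₁X ↠ Y` a surjective
`Λ₁`-linear map (constants `Λ₁`-structure on `X/T₁X`) whose kernel is killed by `p^m`. Then for every structure
map `J : ℤ_p → 𝒪_{ℂ_p}` there is `k` with `C(p^k)·y ∈ π(ch_{Λ₂}(X)·Λ^ur)` for every `y ∈ ch_{Λ₁}(Y)·𝒪⟦T⟧`: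
`(p^k)·ch(Y) ⊆ ch(ker f)·ch(Y) = ch(X/T₁X) = ch(X[T₁])·π(ch X) ⊆ π(ch X)`, then extend scalars — the algebra
of Jetchev–Skinner–Wan's Cor. "bigSelmercontrol" (there with a FINITE kernel and Fitting ideals).
[cite: JetchevSkinnerWan2017, §3.4 Lemma 15 / Cor. 16 of the arXiv numbering (arXiv:1512.06894 pp. 14–15)]
[cite: SkinnerUrban2014, Cor. 3.2.9 (p. 24)] -/
theorem map_le_map_toUnr₂_map_constantCoeff_rat (p : ℕ) [Fact p.Prime] (X : Type*) [AddCommGroup X]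
    [Module (PowerSeries (IwasawaAlgebra p)) X] [Module.Finite (PowerSeries (IwasawaAlgebra p)) X]
    (Y : Type*) [AddCommGroup Y] [Module (IwasawaAlgebra p) Y] [Module.Finite (IwasawaAlgebra p) Y]
    (hY : Module.IsTorsion (IwasawaAlgebra p) Y)
    (f : letI : Module (IwasawaAlgebra p)
              (QuotSMulTop (PowerSeries.X : PowerSeries (IwasawaAlgebra p)) X) :=
            Module.compHom _ (PowerSeries.C (R := IwasawaAlgebra p))
      QuotSMulTop (PowerSeries.X : PowerSeries (IwasawaAlgebra p)) X →ₗ[IwasawaAlgebra p] Y)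
    (hf : Surjective f)
    (hker : ∃ m : ℕ, ∀ q : QuotSMulTop (PowerSeries.X : PowerSeries (IwasawaAlgebra p)) X, f q = 0 →
      ((p : PowerSeries (IwasawaAlgebra p)) ^ m) • q = 0)
    (J : ℤ_[p] →+* PadicComplexInt p) :
    ∃ k : ℕ, ∀ y ∈ (charIdeal (IwasawaAlgebra p) Y).map (PowerSeries.map J),
      PowerSeries.C (((p : ℕ) : PadicComplexInt p) ^ k) * y ∈
        ((charIdeal (PowerSeries (IwasawaAlgebra p)) X).map (IwasawaAlgebra₂.toUnr₂ p J)).map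
          (PowerSeries.constantCoeff (R := PowerSeries (PadicComplexInt p))) := by
  haveI : UniqueFactorizationMonoid (PowerSeries (IwasawaAlgebra p)) :=
    Literature.NumberTheory.IwasawaTheory.uniqueFactorizationMonoid_iwasawaAlgebraTwoVar p
  -- the constants algebra `C : Λ₁ → Λ₂` (NOT Mathlib's default `algebraPowerSeries`, `T ↦ T₁`)
  let alg : Algebra (IwasawaAlgebra p) (PowerSeries (IwasawaAlgebra p)) :=
    @MvPowerSeries.instAlgebra Unit (IwasawaAlgebra p) (IwasawaAlgebra p) _ _ (Algebra.id _)
  letI : Module (IwasawaAlgebra p) X := Module.compHom X (PowerSeries.C (R := IwasawaAlgebra p))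
  have hIST : @IsScalarTower (IwasawaAlgebra p) (PowerSeries (IwasawaAlgebra p)) X alg.toSMul
      inferInstance inferInstance :=
    @IsScalarTower.mk _ _ _ alg.toSMul _ _ fun a r m => by
      rw [@Algebra.smul_def _ _ _ _ alg a r, mul_smul]
      rfl
  have hpΛ : Prime (p : IwasawaAlgebra p) := IwasawaAlgebra.prime_natCast
  obtain ⟨m, hm⟩ := hker
  -- a single nonzero killer of `Y`
  obtain ⟨g, hgann, hg0⟩ := Submodule.annihilator_top_inter_nonZeroDivisors hY
  have hgne : g ≠ 0 := nonZeroDivisors.ne_zero hg0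
  have hgY : ∀ y : Y, g • y = 0 := fun y => Submodule.mem_annihilator.mp hgann y Submodule.mem_top
  -- `X/T₁X` is `Λ₁`-torsion: killed by `p^m · g ≠ 0`
  have hC : ∀ (a : IwasawaAlgebra p) (q : QuotSMulTop (PowerSeries.X : PowerSeries (IwasawaAlgebra p)) X),
      a • q = (PowerSeries.C (R := IwasawaAlgebra p) a) • q := fun _ _ => rfl
  have hkill : ∀ q : QuotSMulTop (PowerSeries.X : PowerSeries (IwasawaAlgebra p)) X,
      ((p : IwasawaAlgebra p) ^ m * g) • q = 0 := fun q => by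
    have hq : f (g • q) = 0 := by rw [map_smul, hgY]
    have := hm (g • q) hq
    rw [hC, map_mul, map_pow, map_natCast, mul_smul, ← hC]
    exact this
  have hne : (p : IwasawaAlgebra p) ^ m * g ≠ 0 := mul_ne_zero (pow_ne_zero m hpΛ.ne_zero) hgne
  have htorsQ : Module.IsTorsion (IwasawaAlgebra p)
      (QuotSMulTop (PowerSeries.X : PowerSeries (IwasawaAlgebra p)) X) := fun q =>
    ⟨⟨(p : IwasawaAlgebra p) ^ m * g, mem_nonZeroDivisors_of_ne_zero hne⟩, hkill q⟩
  -- hence `X` is killed by some `s` with `s(0) ≠ 0` (determinant trick)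
  have hs : ∃ s : PowerSeries (IwasawaAlgebra p), PowerSeries.constantCoeff s ≠ 0 ∧ ∀ x : X, s • x = 0 :=
    S2.exists_constantCoeff_ne_zero_of_isTorsion p X htorsQ
  -- Herbrand: `ch(X/T₁X) = ch(X[T₁]) · π(ch X) ⊆ π(ch X)`
  haveI : Module.Finite (IwasawaAlgebra p)
      (QuotSMulTop (PowerSeries.X : PowerSeries (IwasawaAlgebra p)) X) :=
    @moduleFinite_quotSMulTop (IwasawaAlgebra p) _ X _ _ _ hIST _
  have hHerb := @charIdeal_quotSMulTop_eq_mul (IwasawaAlgebra p) _ _ _ _ _ X _ _ _ _ hIST hs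
  have h1 : charIdeal (IwasawaAlgebra p) (QuotSMulTop (PowerSeries.X : PowerSeries (IwasawaAlgebra p)) X) ≤
      (charIdeal (PowerSeries (IwasawaAlgebra p)) X).map (PowerSeries.constantCoeff (R := IwasawaAlgebra p)) := by
    rw [hHerb]
    exact Ideal.mul_le_left
  -- multiplicativity along `0 → ker f → X/T₁X → Y → 0`
  haveI : IsNoetherian (IwasawaAlgebra p)
      (QuotSMulTop (PowerSeries.X : PowerSeries (IwasawaAlgebra p)) X) :=
    isNoetherian_of_isNoetherianRing_of_finite _ _
  have h2 := charIdeal_eq_mul_of_exact htorsQ (LinearMap.ker f).subtype f (Submodule.subtype_injective _) hf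
    (LinearMap.exact_subtype_ker_map f)
  -- `p^a ∈ ch(ker f)`
  have hkerkill : ∃ m' : ℕ, ∀ x : LinearMap.ker f, ((p : IwasawaAlgebra p) ^ m') • x = 0 := by
    refine ⟨m, fun x => Subtype.ext ?_⟩
    rw [Submodule.coe_smul, Submodule.coe_zero, hC, map_pow, map_natCast]
    exact hm (x : QuotSMulTop (PowerSeries.X : PowerSeries (IwasawaAlgebra p)) X) (LinearMap.mem_ker.mp x.2)
  obtain ⟨a, ha⟩ := exists_pow_mem_charIdeal_of_pow_smul_eq_zero (M := LinearMap.ker f) hpΛ hkerkill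
  -- Λ₁-level conclusion
  have hΛ : Ideal.span {(p : IwasawaAlgebra p) ^ a} * charIdeal (IwasawaAlgebra p) Y ≤
      (charIdeal (PowerSeries (IwasawaAlgebra p)) X).map (PowerSeries.constantCoeff (R := IwasawaAlgebra p)) := by
    refine le_trans ?_ h1
    rw [h2]
    exact Ideal.mul_mono_left ((Ideal.span_singleton_le_iff_mem _).mpr ha)
  -- extend scalars along `J` and read membership-wise
  refine ⟨a, fun y hy => ?_⟩
  rw [Ideal.map_map, S2.constantCoeff_comp_toUnr₂, ← Ideal.map_map]
  have hΛ' := Ideal.map_mono (f := PowerSeries.map J) hΛ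
  rw [Ideal.map_mul, Ideal.map_span, Set.image_singleton, map_pow, map_natCast] at hΛ'
  refine hΛ' (Ideal.mul_mem_mul ?_ hy)
  rw [map_pow, map_natCast]
  exact Ideal.mem_span_singleton_self _

/-! ## §2. The constructed carriers: duality with exponent, and the curve-level rational specialisation -/

section Curve

open NumberField IsDedekindDomain Field
  Literature.NumberTheory.EllipticCurves.Castella2018 Literature.NumberTheory.EllipticCurves.TwoVariableSelmer

variable {K : Type u} [Field K] [NumberField K] (W : WeierstrassCurve K) (p : ℕ) [Fact p.Prime]
  (κ₁ κ₂ : ZpExtension K p) (vbar : HeightOneSpectrum (𝓞 K)) (γ₁ γ₂ : Field.absoluteGaloisGroup K)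
  [hγ : Fact (ZpExtension.IsTopGeneratorPair κ₁ κ₂ γ₁ γ₂)] [Fact (κ₂.IsTopGenerator γ₂)]

/-- **Duality with exponent.** If every `conj_{γ₁}`-fixed class `s ∈ H¹_{nr,v̄}(K̃_∞, E[p^∞])` has `p^m·s` in
the range of the restriction `Sel_v̄^∅(K_∞^{(2)}, E[p^∞]) → H¹_{nr,v̄}(K̃_∞, E[p^∞])` (`selmerAcToUnrSelmer₂`), then
every `x ∈ X_Gr₂` with `toXAc x = 0` has `p^m·x ∈ (T₁)·X_Gr₂`: the character `p^m·x` kills the fixed classes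
(`(p^m·x)(s) = x(p^m·s) = (toXAc x)(a) = 0`), so `WeierstrassCurve.XGr₂.mem_X_smul_top_of_forall` applies.
[cite: SkinnerUrban2014, Prop. 3.2.8 (p. 23)] -/
theorem pow_smul_mem_X_smul_top_of_toXAc_eq_zero {m : ℕ}
    (hctl : ∀ s : unrSelmer₂ κ₁ κ₂ (W.geomPrimaryTorsion p) vbar,
      conjSel₂ κ₁ κ₂ (W.geomPrimaryTorsion p) vbar γ₁ s = s →
        p ^ m • s ∈ Set.range (W.selmerAcToUnrSelmer₂ p κ₁ κ₂ vbar))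
    (x : W.XGr₂ p κ₁ κ₂ vbar γ₁ γ₂) (hx : WeierstrassCurve.XGr₂.toXAc W p κ₁ κ₂ vbar γ₁ γ₂ x = 0) :
    ((p : IwasawaAlgebra₂ p) ^ m) • x ∈ (Ideal.span {(PowerSeries.X : IwasawaAlgebra₂ p)} •
      (⊤ : Submodule (IwasawaAlgebra₂ p) (W.XGr₂ p κ₁ κ₂ vbar γ₁ γ₂))) := by
  have hnat : ((p : IwasawaAlgebra₂ p) ^ m) • x = p ^ m • x := by
    rw [← Nat.cast_pow, Nat.cast_smul_eq_nsmul]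
  rw [hnat]
  refine WeierstrassCurve.XGr₂.mem_X_smul_top_of_forall W p κ₁ κ₂ vbar γ₁ γ₂ (p ^ m • x) fun s hs => ?_
  obtain ⟨a, ha⟩ := hctl s hs
  have h1 : (p ^ m • x) s = x (p ^ m • s) := by
    change (p ^ m • (show unrSelmer₂ κ₁ κ₂ (W.geomPrimaryTorsion p) vbar →+ AddCircle (1 : ℚ) from x)) s =
      (show unrSelmer₂ κ₁ κ₂ (W.geomPrimaryTorsion p) vbar →+ AddCircle (1 : ℚ) from x) (p ^ m • s)
    rw [AddMonoidHom.nsmul_apply, map_nsmul]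
  rw [h1, ← ha, ← WeierstrassCurve.XGr₂.toXAc_apply, hx]
  rfl

/-- **The kernel of the quotient control map `toXAcQuot : X_Gr₂ ⧸ (T₁)·X_Gr₂ → X_ac` is killed by `p^m`** under
the hypothesis of `pow_smul_mem_X_smul_top_of_toXAc_eq_zero`. [cite: SkinnerUrban2014, Prop. 3.2.8 (p. 23)] -/
theorem pow_smul_eq_zero_of_toXAcQuot_eq_zero {m : ℕ}
    (hctl : ∀ s : unrSelmer₂ κ₁ κ₂ (W.geomPrimaryTorsion p) vbar,
      conjSel₂ κ₁ κ₂ (W.geomPrimaryTorsion p) vbar γ₁ s = s →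
        p ^ m • s ∈ Set.range (W.selmerAcToUnrSelmer₂ p κ₁ κ₂ vbar))
    (q : W.XGr₂ p κ₁ κ₂ vbar γ₁ γ₂ ⧸ (Ideal.span {(PowerSeries.X : IwasawaAlgebra₂ p)} •
      (⊤ : Submodule (IwasawaAlgebra₂ p) (W.XGr₂ p κ₁ κ₂ vbar γ₁ γ₂))))
    (hq : WeierstrassCurve.XGr₂.toXAcQuot W p κ₁ κ₂ vbar γ₁ γ₂ q = 0) :
    ((p : IwasawaAlgebra₂ p) ^ m) • q = 0 := by
  obtain ⟨x, rfl⟩ := Submodule.Quotient.mk_surjective _ q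
  rw [WeierstrassCurve.XGr₂.toXAcQuot_mk] at hq
  rw [← Submodule.Quotient.mk_smul, Submodule.Quotient.mk_eq_zero]
  exact pow_smul_mem_X_smul_top_of_toXAc_eq_zero W p κ₁ κ₂ vbar γ₁ γ₂ hctl x hq

/-- **Rational lower-bound specialisation on the constructed carriers.** For `W` elliptic over a number field
`K` with `E(K)[p] = 0`, a generator pair `(κ₁, κ₂; γ₁, γ₂)`, a place `v̄`, `X_ac = X_ac^∅(E/K_∞^{(2)})_{v̄}` a
TORSION `Λ₁`-module, and CONTROL WITH EXPONENT (every `conj_{γ₁}`-fixed class of `H¹_{nr,v̄}(K̃_∞, E[p^∞])` has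
`p^m` times it in the range of restriction from `Sel_v̄^∅(K_∞^{(2)})`): for every structure map `J` there is `k`
with `C(p^k)·ch_{Λ₁}(X_ac)·𝒪⟦T⟧ ⊆ π(ch_{Λ₂}(X_Gr₂)·Λ^ur)` (membership form).
[cite: JetchevSkinnerWan2017, §3.4 (arXiv:1512.06894 pp. 14–15)] [cite: SkinnerUrban2014, Prop. 3.2.8, Cor. 3.2.9 (pp. 23–24)] -/
theorem charIdeal_XAc_map_le_rat [W.IsElliptic] (hK : ∀ P : W.toAffine.Point, p • P = 0 → P = 0)
    (hYt : Module.IsTorsion (IwasawaAlgebra p) (AcSelmer.XAc W p κ₂ vbar ∅ γ₂))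
    (hctl : ∃ m : ℕ, ∀ s : unrSelmer₂ κ₁ κ₂ (W.geomPrimaryTorsion p) vbar,
      conjSel₂ κ₁ κ₂ (W.geomPrimaryTorsion p) vbar γ₁ s = s →
        p ^ m • s ∈ Set.range (W.selmerAcToUnrSelmer₂ p κ₁ κ₂ vbar))
    (J : ℤ_[p] →+* PadicComplexInt p) :
    ∃ k : ℕ, ∀ y ∈ (AcSelmer.XAc.charIdeal W p κ₂ vbar ∅ γ₂).map (PowerSeries.map J),
      PowerSeries.C (((p : ℕ) : PadicComplexInt p) ^ k) * y ∈
        ((WeierstrassCurve.XGr₂.charIdeal W p κ₁ κ₂ vbar γ₁ γ₂).map (IwasawaAlgebra₂.toUnr₂ p J)).map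
          (PowerSeries.constantCoeff (R := PowerSeries (PadicComplexInt p))) := by
  haveI : Module.Finite (IwasawaAlgebra₂ p) (W.XGr₂ p κ₁ κ₂ vbar γ₁ γ₂) :=
    Summit.BirchSwinnertonDyer.BirchSwinnertonDyer.Theorems.SignedBaseChangeAcDivFinitePiece.xGr₂_module_finite
      W p κ₁ κ₂ vbar
  haveI : Module.Finite (IwasawaAlgebra p) (AcSelmer.XAc W p κ₂ vbar ∅ γ₂) :=
    AcSelmer.XAc.module_finite_empty W p κ₂ vbar γ₂
  obtain ⟨m, hm⟩ := hctl
  -- `X_Gr₂ ⧸ T₁ • ⊤ ≃ X_Gr₂ ⧸ (T₁) • ⊤`, then the tree's semilinear control map, made `Λ₁`-linear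
  let e : QuotSMulTop (PowerSeries.X : IwasawaAlgebra₂ p) (W.XGr₂ p κ₁ κ₂ vbar γ₁ γ₂)
      ≃ₗ[IwasawaAlgebra₂ p] (W.XGr₂ p κ₁ κ₂ vbar γ₁ γ₂ ⧸
        (Ideal.span {(PowerSeries.X : IwasawaAlgebra₂ p)} •
          (⊤ : Submodule (IwasawaAlgebra₂ p) (W.XGr₂ p κ₁ κ₂ vbar γ₁ γ₂)))) :=
    Submodule.quotEquivOfEq _ _
      (Submodule.ideal_span_singleton_smul (PowerSeries.X : IwasawaAlgebra₂ p) ⊤).symm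
  let ψ := (WeierstrassCurve.XGr₂.toXAcQuot W p κ₁ κ₂ vbar γ₁ γ₂).comp e.toLinearMap
  have hψ : Surjective ψ :=
    (WeierstrassCurve.XGr₂.toXAcQuot_surjective W p κ₁ κ₂ vbar γ₁ γ₂ hK).comp e.surjective
  letI : Module (IwasawaAlgebra p)
      (QuotSMulTop (PowerSeries.X : IwasawaAlgebra₂ p) (W.XGr₂ p κ₁ κ₂ vbar γ₁ γ₂)) :=
    Module.compHom _ (PowerSeries.C (R := IwasawaAlgebra p))
  let f : QuotSMulTop (PowerSeries.X : IwasawaAlgebra₂ p) (W.XGr₂ p κ₁ κ₂ vbar γ₁ γ₂) →ₗ[IwasawaAlgebra p]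
      AcSelmer.XAc W p κ₂ vbar ∅ γ₂ :=
    { toFun := ψ
      map_add' := ψ.map_add
      map_smul' := fun a q => by
        show ψ ((PowerSeries.C a : IwasawaAlgebra₂ p) • q) = a • ψ q
        rw [ψ.map_smulₛₗ, PowerSeries.constantCoeff_C] }
  have hf : Surjective f := hψ
  have hker : ∃ m : ℕ, ∀ q : QuotSMulTop (PowerSeries.X : IwasawaAlgebra₂ p) (W.XGr₂ p κ₁ κ₂ vbar γ₁ γ₂),
      f q = 0 → ((p : IwasawaAlgebra₂ p) ^ m) • q = 0 := by
    refine ⟨m, fun q hq => ?_⟩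
    have hq' : WeierstrassCurve.XGr₂.toXAcQuot W p κ₁ κ₂ vbar γ₁ γ₂ (e q) = 0 := hq
    have h := pow_smul_eq_zero_of_toXAcQuot_eq_zero W p κ₁ κ₂ vbar γ₁ γ₂ hm (e q) hq'
    have h2 : e (((p : IwasawaAlgebra₂ p) ^ m) • q) = 0 := by rw [e.map_smul]; exact h
    exact e.map_eq_zero_iff.mp h2
  exact map_le_map_toUnr₂_map_constantCoeff_rat p (W.XGr₂ p κ₁ κ₂ vbar γ₁ γ₂) (AcSelmer.XAc W p κ₂ vbar ∅ γ₂)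
    hYt f hf hker J

/-! ## §3. The ♭-inclusion at one datum from a two-variable inclusion whose frame restricts to `(Q)` -/

/-- **The ♭-INCLUSION `ch_Λ(X_ac)·𝒪_{ℂ_p}⟦T⟧ ⊆ (Q)` at one datum** from: (i) a RATIONAL two-variable inclusion
`p^k·ch_{Λ₂}(X_Gr₂)·Λ^ur ⊆ (G)` for a `G ∈ 𝒪_{ℂ_p}⟦T₁⟧⟦T₂⟧` whose restriction `G(0, T₂)` to the line `T₁ = 0`
generates the same ideal as `Q`; (ii) control with exponent; (iii) `X_ac` torsion and `E(K)[p] = 0`; (iv)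
`μ(Q) = 0` (`HasUnitContent Q`). Proof: §2 gives `C(p^{k'})·ch(X_ac)·𝒪 ⊆ π(ch(X_Gr₂)·Λ^ur)`; `π` of (i) gives
`C(p^k)·π(ch(X_Gr₂)·Λ^ur) ⊆ (π G) = (Q)`; the power of `p` cancels against `μ(Q) = 0`.
[cite: JetchevSkinnerWan2017, §3.4 and Thm. 6.1.4–6.1.5 of the arXiv numbering (arXiv:1512.06894 pp. 14–15, 26)] -/
theorem charIdeal_XAc_map_le_span_of_twoVar [W.IsElliptic] (hK : ∀ P : W.toAffine.Point, p • P = 0 → P = 0)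
    (hYt : Module.IsTorsion (IwasawaAlgebra p) (AcSelmer.XAc W p κ₂ vbar ∅ γ₂))
    (hctl : ∃ m : ℕ, ∀ s : unrSelmer₂ κ₁ κ₂ (W.geomPrimaryTorsion p) vbar,
      conjSel₂ κ₁ κ₂ (W.geomPrimaryTorsion p) vbar γ₁ s = s →
        p ^ m • s ∈ Set.range (W.selmerAcToUnrSelmer₂ p κ₁ κ₂ vbar))
    (J : ℤ_[p] →+* PadicComplexInt p) (Q : PowerSeries (PadicComplexInt p)) (hμ : HasUnitContent Q)
    (h2 : ∃ (k : ℕ) (G : PowerSeries (PowerSeries (PadicComplexInt p))),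
      (∀ y ∈ (WeierstrassCurve.XGr₂.charIdeal W p κ₁ κ₂ vbar γ₁ γ₂).map (IwasawaAlgebra₂.toUnr₂ p J),
        PowerSeries.C (PowerSeries.C (((p : ℕ) : PadicComplexInt p) ^ k)) * y ∈ Ideal.span {G}) ∧
      Ideal.span {PowerSeries.constantCoeff G} = Ideal.span {Q}) :
    (AcSelmer.XAc.charIdeal W p κ₂ vbar ∅ γ₂).map (PowerSeries.map J) ≤ Ideal.span {Q} := by
  obtain ⟨k, G, hG, hGQ⟩ := h2
  obtain ⟨k', hk'⟩ := charIdeal_XAc_map_le_rat W p κ₁ κ₂ vbar γ₁ γ₂ hK hYt hctl J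
  -- `π` of the two-variable inclusion: `C(p^k) · w ∈ (Q)` for every `w ∈ π(ch(X_Gr₂)·Λ^ur)`
  set I₂ := (WeierstrassCurve.XGr₂.charIdeal W p κ₁ κ₂ vbar γ₁ γ₂).map (IwasawaAlgebra₂.toUnr₂ p J) with hI₂
  have hπ : ∀ w ∈ I₂.map (PowerSeries.constantCoeff (R := PowerSeries (PadicComplexInt p))),
      PowerSeries.C (((p : ℕ) : PadicComplexInt p) ^ k) * w ∈ Ideal.span {Q} := by
    intro w hw
    rw [← hGQ]
    refine Submodule.span_induction (p := fun w _ => PowerSeries.C (((p : ℕ) : PadicComplexInt p) ^ k) * w ∈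
      Ideal.span {PowerSeries.constantCoeff G}) ?_ ?_ ?_ ?_ hw
    · rintro _ ⟨y, hy, rfl⟩
      have h := Ideal.mem_map_of_mem (PowerSeries.constantCoeff (R := PowerSeries (PadicComplexInt p))) (hG y hy)
      rw [map_mul, PowerSeries.constantCoeff_C, Ideal.map_span, Set.image_singleton] at h
      exact h
    · rw [mul_zero]; exact Ideal.zero_mem _
    · intro a b _ _ ha hb
      rw [mul_add]
      exact Ideal.add_mem _ ha hb
    · intro r a _ ha
      rw [smul_eq_mul, mul_left_comm]
      exact Ideal.mul_mem_left _ r ha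
  -- combine and cancel the power of `p` against `μ(Q) = 0`
  refine SignedBaseChangeAcDivRatToInt.le_span_of_forall_C_pow_mul_mem_of_hasUnitContent hμ (k := k + k') ?_
  intro y hy
  have h1 := hπ _ (hk' y hy)
  rw [← mul_assoc, ← map_mul, ← pow_add] at h1
  exact h1

/-- **The ♭-INCLUSION from the ANTICYCLOTOMIC SPECIALISATION of the two-variable characteristic ideal**
(appended, LEAD cruxlead-19357 g7, v21 of the tame lines): the same conclusion as
`charIdeal_XAc_map_le_span_of_twoVar` from the WEAKER, source-robust input its proof actually reads —
`C(p^k) · w ∈ (Q)` for every `w` in `π(ch_{Λ₂}(X_Gr₂)·Λ^ur)`, `π : T₁ ↦ 0` (`PowerSeries.constantCoeff` in the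
outer variable). This is what a two-variable divisibility «away from the cyclotomic variable» (Wan 2020
Thm. 1.1 for a Hida family; Castella–Liu–Wan 2022 Thm. 8.2.1 (1)) yields after cancelling the power of `T₁` in
its denominator and comparing the restricted frame with `Q`. Proof: §2 (`charIdeal_XAc_map_le_rat`) and the
cancellation of `p^{k+k'}` against `μ(Q) = 0`.
[cite: JetchevSkinnerWan2017, §3.4 and Thm. 6.1.4–6.1.5 of the arXiv numbering (arXiv:1512.06894 pp. 14–15, 26)] -/
theorem charIdeal_XAc_map_le_span_of_twoVarSpec [W.IsElliptic]
    (hK : ∀ P : W.toAffine.Point, p • P = 0 → P = 0)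
    (hYt : Module.IsTorsion (IwasawaAlgebra p) (AcSelmer.XAc W p κ₂ vbar ∅ γ₂))
    (hctl : ∃ m : ℕ, ∀ s : unrSelmer₂ κ₁ κ₂ (W.geomPrimaryTorsion p) vbar,
      conjSel₂ κ₁ κ₂ (W.geomPrimaryTorsion p) vbar γ₁ s = s →
        p ^ m • s ∈ Set.range (W.selmerAcToUnrSelmer₂ p κ₁ κ₂ vbar))
    (J : ℤ_[p] →+* PadicComplexInt p) (Q : PowerSeries (PadicComplexInt p)) (hμ : HasUnitContent Q)
    (h2 : ∃ k : ℕ, ∀ w ∈ ((WeierstrassCurve.XGr₂.charIdeal W p κ₁ κ₂ vbar γ₁ γ₂).map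
        (IwasawaAlgebra₂.toUnr₂ p J)).map (PowerSeries.constantCoeff (R := PowerSeries (PadicComplexInt p))),
      PowerSeries.C (((p : ℕ) : PadicComplexInt p) ^ k) * w ∈ Ideal.span {Q}) :
    (AcSelmer.XAc.charIdeal W p κ₂ vbar ∅ γ₂).map (PowerSeries.map J) ≤ Ideal.span {Q} := by
  obtain ⟨k, hπ⟩ := h2
  obtain ⟨k', hk'⟩ := charIdeal_XAc_map_le_rat W p κ₁ κ₂ vbar γ₁ γ₂ hK hYt hctl J
  refine SignedBaseChangeAcDivRatToInt.le_span_of_forall_C_pow_mul_mem_of_hasUnitContent hμ (k := k + k') ?_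
  intro y hy
  have h1 := hπ _ (hk' y hy)
  rw [← mul_assoc, ← map_mul, ← pow_add] at h1
  exact h1

end Curve

end S2L

end Summit.BirchSwinnertonDyer.BirchSwinnertonDyer.Theorems.TameSpecialization

end
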